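import Summits.CriticalPhenomena.Ising3DConformalLimit.Statement
import Summits.CriticalPhenomena.Ising3DConformalLimit.Theses.TauBallRounding
import Summits.CriticalPhenomena.Ising3DConformalLimit.Theses.HyperoctahedralRP
import Summits.CriticalPhenomena.Ising3DConformalLimit.Theorems.MonotoneBlockingLimitsAreConformalSummit
import Summits.CriticalPhenomena.Ising3DConformalLimit.Theorems.HyperoctahedralRPLimitRotationInvariant
import Summits.CriticalPhenomena.Ising3DConformalLimit.Theorems.HyperoctahedralRPHRP2Rigidity
import HarnessLib

/-!
# Certificate: WHERE THE SUMMIT SITS on route `TauBallRounding` — and that crux `MonotoneRounding`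
# (stmt-CriticalPhenomena-4807) is OFF its summit cone

Strategist seat planner-cstrat-stmt-CriticalPhenomena-4807-r1-0 (crux-strategist r1, RESTATED redirect), 2026-08-17.
Pure assembly over LANDED theorems; no `sorry`, no new mathematics.  Facts certified here:

1. `roundnessTransfer_of_tree` — the route's bridge (B) `RoundnessTransfer` (item 4809, still OPEN on the ledger) is a
   theorem of the tree with its τ-premise DISCARDED: rotation invariance of every normalised, non-degenerate,
   translation-invariant, scale-covariant pointwise scaling limit of `criticalCorr 3` is
   `limitRotationInvariant_proof HRP2Rigidity_of` (items 1980 / 1979 of HyperoctahedralRP, both CLOSED).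
2. `closes_without_T1_T2_B` — the sub-problem follows from the three shared hubs (C) `ExistsScaleCovariantLimit` (1981),
   (D) `InversionUpgradeNormalised` (1982), (E) `IsingEuclidUpgradeR4NonGaussian` (0636) ALONE: the binders
   `MonotoneRounding` (T1, 4807), `RoundEndpoint` (T2, 4808), `RoundnessTransfer` (B, 4809) of the route's `closes` are not
   needed.
3. `summit_iff_hubs_TBR` — and those three hubs are jointly EXACTLY the sub-problem (`summit_iff_three_hubs`, read at this
   route's byte-identical copies of the decls): the route's summit cone is the summit itself.
4. `closes_factors` — the route's own deciding theorem, re-derived: whatever T1/T2/B say, `closes` = (2) ∘ projections.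
Consequence: `MonotoneRounding` is logically INDEPENDENT of the sub-problem as far as the tree knows (probes
`bc/MonotoneRounding_probe*.lean`: `C → S`, `S → C` unsolved) and contributes NOTHING to it on this route — a FRONTIER
statement (the τ-ball rounds monotonically), not distance-to-summit.  The route header's own KILL CRITERIA clause
"TwoPointLimitIsotropic proved via HyperoctahedralRP moots r2–r4 for the summit (T1, T2 keep independent value)" has fired
(item 1984 `twoPointLimitIsotropic_proof`, item 1980 `limitRotationInvariant_proof`).
-/

noncomputable section

open Literature.Probability.LatticeModels
open Summit.CriticalPhenomena.Ising3DConformalLimit.Theses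

namespace Summit.CriticalPhenomena.Ising3DConformalLimit.Cruxes.MonotoneRounding.StrategistR1

/-- (1) The bridge (B) of route TauBallRounding is a theorem of the tree, premise discarded. -/
theorem roundnessTransfer_of_tree : TauBallRounding.RoundnessTransfer := by
  intro _hRound ρ Δ S hρ hlim hnorm hnd htr hsc
  exact Cruxes.LimitRotationInvariant.QuarterTurnLiouville.limitRotationInvariant_proof
    Cruxes.HRP2Rigidity.XRayMellin.HRP2Rigidity_of ρ Δ S hρ hlim hnorm hnd htr hsc

/-- (1') The same fact with NO premise at all: O(3)-invariance of every normalised, non-degenerate,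
translation-invariant, scale-covariant pointwise scaling limit of the critical `ℤ³` Ising correlators. -/
theorem rotationInvariant_of_tree :
    ∀ (ρ : ℝ → ℝ) (Δ : ℝ) (S : CorrFamily 3), (∀ δ ∈ Set.Ioc (0:ℝ) 1, 0 < ρ δ) →
      HasPointwiseScalingLimit (criticalCorr 3) ρ S → (∀ n z, z ∉ NonCoincident 3 n → S n z = 0) →
      IsNondegenerateTwoPoint S → IsTranslationInvariant S → IsScaleCovariant Δ S → IsRotationInvariant S :=
  Cruxes.LimitRotationInvariant.QuarterTurnLiouville.limitRotationInvariant_proof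
    Cruxes.HRP2Rigidity.XRayMellin.HRP2Rigidity_of

/-- (2) The sub-problem from the three shared hubs alone — T1, T2, B dropped from `closes`. -/
theorem closes_without_T1_T2_B
    (hC : TauBallRounding.ExistsScaleCovariantLimit)
    (hD : TauBallRounding.InversionUpgradeNormalised)
    (hE : TauBallRounding.IsingEuclidUpgradeR4NonGaussian) : _root_.Ising3DConformalLimit := by
  obtain ⟨ρ, Δ, S, hρ, hΔ, hlim, hnorm, hnd, htr, hsc⟩ := hC
  have hrot : IsRotationInvariant S := rotationInvariant_of_tree ρ Δ S hρ hlim hnorm hnd htr hsc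
  have heuc : IsEuclideanInvariant S := ⟨htr, hrot⟩
  have hinv : IsInversionCovariant Δ S := hD ρ Δ S hρ hlim hnorm hnd heuc hsc
  have hmoeb : IsMoebiusCovariant Δ S := ⟨heuc, hsc, hinv⟩
  exact ⟨ρ, Δ, S, hρ, hΔ, hlim, hnd, hmoeb, hE ρ S hρ hlim hnd⟩

/-- (3) The three hubs are jointly EXACTLY the sub-problem, at this route's copies of the decls
(`LimitsAreConformalSummit.summit_iff_three_hubs`, items 1981 ∧ 1982 ∧ 0636; δ-identical bodies). -/
theorem summit_iff_hubs_TBR :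
    _root_.Ising3DConformalLimit ↔
      (TauBallRounding.ExistsScaleCovariantLimit ∧ TauBallRounding.InversionUpgradeNormalised ∧
        TauBallRounding.IsingEuclidUpgradeR4NonGaussian) :=
  Theorems.LimitsAreConformalSummit.summit_iff_three_hubs

/-- (3') In particular each hub is a CONSEQUENCE of the sub-problem (so none is vacuous decoration)… -/
theorem hubs_of_summit (h : _root_.Ising3DConformalLimit) :
    TauBallRounding.ExistsScaleCovariantLimit ∧ TauBallRounding.InversionUpgradeNormalised ∧
      TauBallRounding.IsingEuclidUpgradeR4NonGaussian :=
  summit_iff_hubs_TBR.1 h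

/-- (4) …and the route's deciding theorem factors through (2): its T1/T2/B binders are idle for the summit. -/
theorem closes_factors (h₁ : TauBallRounding.MonotoneRounding) (h₂ : TauBallRounding.RoundEndpoint)
    (h₃ : TauBallRounding.RoundnessTransfer) (hC : TauBallRounding.ExistsScaleCovariantLimit)
    (hD : TauBallRounding.InversionUpgradeNormalised) (hE : TauBallRounding.IsingEuclidUpgradeR4NonGaussian) :
    TauBallRounding.closes h₁ h₂ h₃ hC hD hE = closes_without_T1_T2_B hC hD hE :=
  rfl  -- proof irrelevance: both are proofs of the same Prop

/-- (5) The honest residual shape of the route for the summit: S needs exactly the three hubs; given them, the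
conjunction `MonotoneRounding ∧ RoundEndpoint ∧ RoundnessTransfer` adds nothing (and `RoundnessTransfer` holds outright). -/
theorem summit_iff_hubs_ignoring_T1 (h₁ : TauBallRounding.MonotoneRounding) :
    _root_.Ising3DConformalLimit ↔
      (TauBallRounding.ExistsScaleCovariantLimit ∧ TauBallRounding.InversionUpgradeNormalised ∧
        TauBallRounding.IsingEuclidUpgradeR4NonGaussian) :=
  summit_iff_hubs_TBR

end Summit.CriticalPhenomena.Ising3DConformalLimit.Cruxes.MonotoneRounding.StrategistR1

end
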